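import Literature.Barriers.CriticalPhenomena.KozmaNachmiasLemma23B2
import HarnessLib

/-!
# Kozma–Nachmias 2011, Lemma 2.3: the terms `B₁` and `B₃`

Barrier catalogue `Literature/Barriers/CriticalPhenomena/` (D-0021), companion of
`KozmaNachmiasOneArm.lean`. All PROVED:

* `mem_clusterSizeGe_of_mem_siteToBoundary` — `{0 ↔ ∂Q_n} ⊆ {|C(0)| ≥ n+1}` (an open path from `0`
  to `∂Q_n` meets every sphere `∂Q_k`, `k ≤ n`); with (1.1) this is the "uninteresting range
  `ε ≤ 2r^{-3}`" of the proof of Lemma 2.3 (p. 382: "we simply use Barsky–Aizenman (1.1) and get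
  `γ(r(1+λ)) ≤ C/√r`") and the term `B₁ = {|C(0)| ≥ εr⁴}`;
* `mul_real_card_filter_ge_le_sum` — Markov's inequality for a count of events,
  `a · P(|{i : G_i}| ≥ a) ≤ Σ_i P(G_i)`;
* `sum_annulusConnCount_le_encard` — the annuli `Q_{j_i + L} ∖ Q_{j_i}`, `j_i = j₁ + iL`, are
  disjoint, so `Σ_i A_{j_i} ≤ |C(0)|` (p. 383: "if `|C(0)| < εr⁴`, then
  `|{i : A_{j_i} ≥ c₂L⁴}| < εr⁴/(c₂L⁴)`");
* `real_compl_clusterSizeGe_inter_forall_lt_le` — **the term `B₃`** (pp. 383–384): if Theorem 2 gives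
  `P(X_{j_i} ≥ L², A_{j_i} ≤ cL⁴) ≤ (1-c) γ(j₁)` for the `N` radii `j_i = j₁ + iL ≤ j₂` and
  `V/(cL⁴) ≤ cN/2`, then `P(|C(0)| < V, X_j > T ∀ j ∈ [j₁, j₂]) ≤ (1 - c/2) γ(j₁)` (`T ≥ L²`), by
  Markov's inequality for `I = |{i : X_{j_i} ≥ L² and A_{j_i} < cL⁴}|`, which on the event is at least
  `N - V/(cL⁴)`.

## References

* G. Kozma, A. Nachmias, J. Amer. Math. Soc. 24 (2011) 375–409: proof of Lemma 2.3, pp. 382–384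
  (the uninteresting range, the terms `B₁` and `B₃`).
-/

noncomputable section

namespace Literature.Barriers.CriticalPhenomena

open _root_.MeasureTheory Finset Literature.Probability.LatticeModels Literature.Probability.Percolation
  Literature.Probability.Percolation.DCT16
open scoped Literature.Probability.LatticeModels Literature.Probability.Percolation ENNReal

variable {d : ℕ}

/-! ### `{0 ↔ ∂Q_n} ⊆ {|C(0)| ≥ n + 1}` -/

section B1

/-- **An arm to distance `n` has at least `n + 1` sites**: for `ω ⊆ E(ℤ^d)` (`d ≥ 1`),
`0 ↔ ∂Q_n` implies `|C(0)| ≥ n + 1`, since by first exit `0 ↔ ∂Q_k` for every `k ≤ n` and the spheres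
`∂Q_k` are disjoint. Used with (1.1) for the range `ε ≤ 2r^{-3}` of the proof of Lemma 2.3
("`γ(r(1+λ)) ≤ C/√r`", p. 382). [cite: KozmaNachmias2011, proof of Lemma 2.3 (p. 382, the case ε ≤ 2r⁻³)] -/
theorem mem_clusterSizeGe_of_mem_siteToBoundary (hd : 1 ≤ d) {ω : BondConfig (Site d)}
    (hω : ω ⊆ (zdGraph d).edgeSet) {n : ℕ} (h : ω ∈ siteToBoundary d n) :
    ω ∈ clusterSizeGe (0 : Site d) (n + 1) := by
  classical
  have hk : ∀ k, k ≤ n → ∃ y ∈ sphere d k, (openGraph ω).Reachable 0 y := by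
    intro k hkn
    obtain ⟨y, hy, hpath⟩ := mem_siteToBoundary_of_le hω hkn h
    rw [innerBoundary_box_of (Or.inl hd)] at hy
    exact ⟨y, hy, reachable_of_pathIn (pathIn_of_mem_openConnIn hpath)⟩
  choose! y hy hreach using hk
  have hmem : ∀ a ∈ Finset.range (n + 1), a ≤ n := fun a ha => Nat.lt_succ_iff.1 (Finset.mem_range.1 ha)
  have hinj : Set.InjOn y ↑(Finset.range (n + 1)) := by
    intro a ha b hb hab
    have ha' := hy a (hmem a ha)
    have hb' := hy b (hmem b hb)
    rw [mem_sphere] at ha' hb'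
    rw [← ha', ← hb', hab]
  have hcard : ((Finset.range (n + 1)).image y).card = n + 1 := by
    rw [Finset.card_image_of_injOn hinj, Finset.card_range]
  have hsub : (↑((Finset.range (n + 1)).image y) : Set (Site d)) ⊆ openCluster ω 0 := by
    intro z hz
    rw [Finset.coe_image] at hz
    obtain ⟨k, hk, rfl⟩ := hz
    exact hreach k (hmem k hk)
  rw [mem_clusterSizeGe]
  calc ((n + 1 : ℕ) : ℕ∞) = (↑((Finset.range (n + 1)).image y) : Set (Site d)).encard := by
        rw [Set.encard_coe_eq_coe_finsetCard, hcard]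
    _ ≤ (openCluster ω 0).encard := Set.encard_le_encard hsub

/-- Hence `P(0 ↔ ∂Q_n) ≤ P(|C(0)| ≥ n + 1)` (`d ≥ 1`). [cite: KozmaNachmias2011, proof of Lemma 2.3 (p. 382, the case ε ≤ 2r⁻³)] -/
theorem oneArmProb_le_real_clusterSizeGe (hd : 1 ≤ d) (p : unitInterval) (n : ℕ) :
    oneArmProb d p n ≤ (bondPercolation (zdGraph d) p).real (clusterSizeGe (0 : Site d) (n + 1)) :=
  real_mono_of_forall_subset_edgeSet (zdGraph d) p fun _ hω h =>
    mem_clusterSizeGe_of_mem_siteToBoundary hd hω h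

end B1

/-! ### Markov's inequality for a count of events, and the disjoint annuli -/

section Counting

open scoped Classical in
/-- **Markov's inequality for a count**: for finitely many measurable events `E_i` and any real `a`,
`a · P(|{i ∈ s : E_i occurs}| ≥ a) ≤ Σ_{i ∈ s} P(E_i)` (the expectation of the count).
[folklore] -/
theorem mul_real_card_filter_ge_le_sum {Ω ι : Type*} [MeasurableSpace Ω] (μ : Measure Ω)
    [IsFiniteMeasure μ] (s : Finset ι) {E : ι → Set Ω} (hE : ∀ i ∈ s, MeasurableSet (E i)) (a : ℝ) :
    a * μ.real {ω | a ≤ ((s.filter fun i => ω ∈ E i).card : ℝ)} ≤ ∑ i ∈ s, μ.real (E i) := by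
  classical
  set f : Ω → ℝ := fun ω => ∑ i ∈ s, (E i).indicator (fun _ => (1 : ℝ)) ω with hf
  have hfeq : ∀ ω, ((s.filter fun i => ω ∈ E i).card : ℝ) = f ω := by
    intro ω
    rw [hf, Finset.card_filter]
    push_cast
    refine Finset.sum_congr rfl fun i _ => ?_
    by_cases h : ω ∈ E i <;> simp [h]
  have hint : Integrable f μ :=
    integrable_finsetSum s fun i hi => (integrable_const (1 : ℝ)).indicator (hE i hi)
  have hnn : 0 ≤ᵐ[μ] f := ae_of_all _ fun ω =>
    Finset.sum_nonneg fun i _ => Set.indicator_nonneg (fun _ _ => zero_le_one) _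
  have hset : {ω | a ≤ ((s.filter fun i => ω ∈ E i).card : ℝ)} = {ω | a ≤ f ω} := by
    ext ω; rw [Set.mem_setOf_eq, Set.mem_setOf_eq, hfeq]
  rw [hset]
  refine (mul_meas_ge_le_integral_of_nonneg hnn hint a).trans_eq ?_
  rw [integral_finsetSum s fun i hi => (integrable_const (1 : ℝ)).indicator (hE i hi)]
  refine Finset.sum_congr rfl fun i hi => ?_
  rw [integral_indicator_const _ (hE i hi), smul_eq_mul, mul_one]

/-- **The annuli are disjoint** (Kozma–Nachmias 2011, p. 383): with `j_i = j₁ + iL`, the sets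
`Q_{j_i+L} ∖ Q_{j_i}` are pairwise disjoint, so `Σ_{i<N} A_{j_i} ≤ |C(0)|`.
[cite: KozmaNachmias2011, proof of Lemma 2.3 (term B₃, p. 383)] -/
theorem sum_annulusConnCount_le_encard (j₁ L N : ℕ) (ω : BondConfig (Site d)) :
    ((∑ i ∈ Finset.range N, annulusConnCount d (j₁ + i * L) L ω : ℕ) : ℕ∞) ≤
      (openCluster ω (0 : Site d)).encard := by
  classical
  set F : ℕ → Finset (Site d) := fun i =>
    (box d (j₁ + i * L + L) \ box d (j₁ + i * L)).filter fun y => ω ∈ openConn (0 : Site d) y with hF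
  have hA : ∀ i, annulusConnCount d (j₁ + i * L) L ω = #(F i) := by
    intro i; unfold annulusConnCount; rfl
  have hdisj : ∀ i ∈ Finset.range N, ∀ i' ∈ Finset.range N, i ≠ i' → Disjoint (F i) (F i') := by
    -- reduce to `i < i'`
    suffices key : ∀ i i', i < i' → Disjoint (F i) (F i') by
      intro i _ i' _ hne
      rcases lt_or_gt_of_ne hne with h | h
      · exact key i i' h
      · exact (key i' i h).symm
    intro i i' hlt
    rw [Finset.disjoint_left]
    intro y hy hy'
    have h1 : y ∈ box d (j₁ + i * L + L) := (Finset.mem_sdiff.1 (Finset.mem_filter.1 hy).1).1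
    have h2 : y ∉ box d (j₁ + i' * L) := (Finset.mem_sdiff.1 (Finset.mem_filter.1 hy').1).2
    have hle : j₁ + i * L + L ≤ j₁ + i' * L := by
      have : (i + 1) * L ≤ i' * L := Nat.mul_le_mul_right L hlt
      nlinarith
    exact h2 (box_mono d hle h1)
  have hsub : (↑((Finset.range N).biUnion F) : Set (Site d)) ⊆ openCluster ω 0 := by
    intro y hy
    rw [Finset.mem_coe, Finset.mem_biUnion] at hy
    obtain ⟨i, -, hyi⟩ := hy
    exact (Finset.mem_filter.1 hyi).2
  calc ((∑ i ∈ Finset.range N, annulusConnCount d (j₁ + i * L) L ω : ℕ) : ℕ∞)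
      = ((#((Finset.range N).biUnion F) : ℕ) : ℕ∞) := by
        rw [Finset.card_biUnion (by intro i hi i' hi' hne; exact hdisj i hi i' hi' hne)]
        simp only [hA]
    _ = (↑((Finset.range N).biUnion F) : Set (Site d)).encard := (Set.encard_coe_eq_coe_finsetCard _).symm
    _ ≤ (openCluster ω 0).encard := Set.encard_le_encard hsub

/-- On `{|C(0)| < V}`, `Σ_{i<N} A_{j_i} < V`. [cite: KozmaNachmias2011, proof of Lemma 2.3 (term B₃, p. 383)] -/
theorem sum_annulusConnCount_lt_of_not_mem_clusterSizeGe (j₁ L N : ℕ) {V : ℕ}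
    {ω : BondConfig (Site d)} (hω : ω ∉ clusterSizeGe (0 : Site d) V) :
    ∑ i ∈ Finset.range N, annulusConnCount d (j₁ + i * L) L ω < V := by
  rw [mem_clusterSizeGe, not_le] at hω
  have h := (sum_annulusConnCount_le_encard j₁ L N ω).trans_lt hω
  exact_mod_cast h

end Counting

/-! ### The term `B₃` -/

section B3

variable (p : unitInterval)

/-- The events of Theorem 2 are measurable. [folklore] -/
theorem measurableSet_thm2Event (d j L : ℕ) (c : ℝ) :
    MeasurableSet {ω : BondConfig (Site d) | ((L : ℝ)) ^ 2 ≤ (boundaryConnCount d j ω : ℝ) ∧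
      (annulusConnCount d j L ω : ℝ) ≤ c * (L : ℝ) ^ 4} :=
  (measurableSet_le measurable_const (measurable_boundaryConnCount d j)).inter
    (measurableSet_le (measurable_annulusConnCount d j L) measurable_const)

/-- The arithmetic of the Markov step: if `0 ≤ β ≤ cN/2`, `0 < c ≤ 1`, `0 < N`, then
`N(1-c) ≤ (1 - c/2)(N - β)` and `0 < N - β`. [folklore] -/
theorem markov_arith {c N β : ℝ} (hc0 : 0 < c) (hc1 : c ≤ 1) (hN : 0 < N) (hβ0 : 0 ≤ β)
    (hβ : β ≤ c * N / 2) : N * (1 - c) ≤ (1 - c / 2) * (N - β) ∧ 0 < N - β := by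
  constructor
  · nlinarith
  · nlinarith

open scoped Classical in
/-- **The term `B₃` of Kozma–Nachmias 2011, Lemma 2.3** (pp. 383–384). Let `j_i = j₁ + iL ≤ j₂`
(`i < N`, `L ≥ 1`, `N ≥ 1`), `T ≥ L²`, `0 < c ≤ 1`, and suppose (Theorem 2, with the monotonicity of
`γ`) `P(X_{j_i} ≥ L² and A_{j_i} ≤ cL⁴) ≤ (1 - c) γ(j₁)` for all `i < N`, and `V/(cL⁴) ≤ cN/2`. Then
`P(|C(0)| < V and X_j > T for all j ∈ [j₁, j₂]) ≤ (1 - c/2) γ(j₁)`.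
Printed proof: with `I = |{i : X_{j_i} ≥ L² and A_{j_i} < cL⁴}|`, on the event every `X_{j_i} > T ≥ L²`
and, the annuli being disjoint, fewer than `V/(cL⁴)` indices have `A_{j_i} > cL⁴`, so
`I ≥ N - V/(cL⁴)`; by Markov `P ≤ E I/(N - V/(cL⁴)) ≤ N(1-c)γ(j₁)/(N - V/(cL⁴)) ≤ (1 - c/2)γ(j₁)`.
[cite: KozmaNachmias2011, proof of Lemma 2.3 (term B₃, pp. 383–384)] -/
theorem real_compl_clusterSizeGe_inter_forall_lt_le {c : ℝ} (hc0 : 0 < c) (hc1 : c ≤ 1)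
    {j₁ j₂ L N V : ℕ} {T : ℝ} (hL : 1 ≤ L) (hN1 : 1 ≤ N) (hNj : ∀ i < N, j₁ + i * L ≤ j₂)
    (hLT : ((L : ℝ)) ^ 2 ≤ T)
    (hG : ∀ i < N, (bondPercolation (zdGraph d) p).real
      {ω | ((L : ℝ)) ^ 2 ≤ (boundaryConnCount d (j₁ + i * L) ω : ℝ) ∧
        (annulusConnCount d (j₁ + i * L) L ω : ℝ) ≤ c * (L : ℝ) ^ 4} ≤
      (1 - c) * oneArmProb d p j₁)
    (hβ : (V : ℝ) / (c * (L : ℝ) ^ 4) ≤ c * N / 2) :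
    (bondPercolation (zdGraph d) p).real ((clusterSizeGe (0 : Site d) V)ᶜ ∩
        {ω | ∀ j ∈ Finset.Icc j₁ j₂, T < (boundaryConnCount d j ω : ℝ)}) ≤
      (1 - c / 2) * oneArmProb d p j₁ := by
  classical
  set μ := bondPercolation (zdGraph d) p with hμ
  set G : ℕ → Set (BondConfig (Site d)) := fun i =>
    {ω | ((L : ℝ)) ^ 2 ≤ (boundaryConnCount d (j₁ + i * L) ω : ℝ) ∧
      (annulusConnCount d (j₁ + i * L) L ω : ℝ) ≤ c * (L : ℝ) ^ 4} with hG_def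
  set β : ℝ := (V : ℝ) / (c * (L : ℝ) ^ 4) with hβ_def
  have hL0 : (0 : ℝ) < L := by exact_mod_cast hL
  have hcL : 0 < c * (L : ℝ) ^ 4 := by positivity
  have hβ0 : 0 ≤ β := by positivity
  have hN0 : (0 : ℝ) < N := by exact_mod_cast hN1
  obtain ⟨harith, ha0⟩ := markov_arith hc0 hc1 hN0 hβ0 hβ
  set a : ℝ := N - β with ha_def
  -- on the event, the count `I` of good indices is at least `a`
  have hincl : (clusterSizeGe (0 : Site d) V)ᶜ ∩
      {ω | ∀ j ∈ Finset.Icc j₁ j₂, T < (boundaryConnCount d j ω : ℝ)} ⊆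
        {ω | a ≤ (((Finset.range N).filter fun i => ω ∈ G i).card : ℝ)} := by
    rintro ω ⟨hωV, hωT⟩
    rw [Set.mem_compl_iff] at hωV
    -- the bad indices: `A_{j_i} > cL⁴`
    set bad := (Finset.range N).filter fun i => c * (L : ℝ) ^ 4 < (annulusConnCount d (j₁ + i * L) L ω : ℝ)
      with hbad
    have hsumlt : ((∑ i ∈ Finset.range N, annulusConnCount d (j₁ + i * L) L ω : ℕ) : ℝ) < V := by
      exact_mod_cast sum_annulusConnCount_lt_of_not_mem_clusterSizeGe j₁ L N hωV
    have hbadlt : (#bad : ℝ) < β := by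
      rw [hβ_def, lt_div_iff₀ hcL]
      calc (#bad : ℝ) * (c * (L : ℝ) ^ 4) = ∑ i ∈ bad, c * (L : ℝ) ^ 4 := by
            rw [Finset.sum_const, nsmul_eq_mul]
        _ ≤ ∑ i ∈ bad, (annulusConnCount d (j₁ + i * L) L ω : ℝ) :=
            Finset.sum_le_sum fun i hi => (Finset.mem_filter.1 hi).2.le
        _ ≤ ∑ i ∈ Finset.range N, (annulusConnCount d (j₁ + i * L) L ω : ℝ) :=
            Finset.sum_le_sum_of_subset_of_nonneg (Finset.filter_subset _ _) fun i _ _ => by positivity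
        _ < V := by push_cast at hsumlt ⊢; exact hsumlt
    -- the good indices contain `range N ∖ bad`
    have hgood : Finset.range N \ bad ⊆ (Finset.range N).filter fun i => ω ∈ G i := by
      intro i hi
      obtain ⟨hiN, hib⟩ := Finset.mem_sdiff.1 hi
      refine Finset.mem_filter.2 ⟨hiN, ?_, ?_⟩
      · have hj : j₁ + i * L ∈ Finset.Icc j₁ j₂ :=
          Finset.mem_Icc.2 ⟨Nat.le_add_right _ _, hNj i (Finset.mem_range.1 hiN)⟩
        exact hLT.trans (hωT _ hj).le
      · by_contra h
        exact hib (Finset.mem_filter.2 ⟨hiN, not_le.1 h⟩)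
    have hcard : (N : ℝ) - #bad ≤ #((Finset.range N).filter fun i => ω ∈ G i) := by
      have h1 : #(Finset.range N \ bad) ≤ #((Finset.range N).filter fun i => ω ∈ G i) :=
        Finset.card_le_card hgood
      have h2 : #(Finset.range N \ bad) = N - #bad := by
        rw [Finset.card_sdiff_of_subset (Finset.filter_subset _ _), Finset.card_range]
      have h3 : #bad ≤ N := (Finset.card_filter_le _ _).trans (Finset.card_range N).le
      have h4 : ((N - #bad : ℕ) : ℝ) = (N : ℝ) - #bad := Nat.cast_sub h3
      rw [← h4, ← h2]
      exact_mod_cast h1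
    show a ≤ _
    rw [ha_def]
    linarith
  -- Markov
  have hmarkov : a * μ.real {ω | a ≤ (((Finset.range N).filter fun i => ω ∈ G i).card : ℝ)} ≤
      ∑ i ∈ Finset.range N, μ.real (G i) := by
    convert mul_real_card_filter_ge_le_sum μ (Finset.range N) (E := G)
      (fun i _ => measurableSet_thm2Event d (j₁ + i * L) L c) a
  have hsumG : ∑ i ∈ Finset.range N, μ.real (G i) ≤ N * ((1 - c) * oneArmProb d p j₁) := by
    calc ∑ i ∈ Finset.range N, μ.real (G i) ≤ ∑ i ∈ Finset.range N, (1 - c) * oneArmProb d p j₁ :=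
          Finset.sum_le_sum fun i hi => hG i (Finset.mem_range.1 hi)
      _ = N * ((1 - c) * oneArmProb d p j₁) := by rw [Finset.sum_const, Finset.card_range, nsmul_eq_mul]
  have hγ0 : 0 ≤ oneArmProb d p j₁ := measureReal_nonneg
  have hkey : a * μ.real ((clusterSizeGe (0 : Site d) V)ᶜ ∩
      {ω | ∀ j ∈ Finset.Icc j₁ j₂, T < (boundaryConnCount d j ω : ℝ)}) ≤
        N * ((1 - c) * oneArmProb d p j₁) :=
    (mul_le_mul_of_nonneg_left (measureReal_mono hincl) ha0.le).trans (hmarkov.trans hsumG)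
  rw [← le_div_iff₀' ha0] at hkey
  refine hkey.trans ?_
  rw [div_le_iff₀ ha0]
  calc (N : ℝ) * ((1 - c) * oneArmProb d p j₁) = (N * (1 - c)) * oneArmProb d p j₁ := by ring
    _ ≤ ((1 - c / 2) * (N - β)) * oneArmProb d p j₁ := mul_le_mul_of_nonneg_right harith hγ0
    _ = (1 - c / 2) * oneArmProb d p j₁ * a := by rw [ha_def]; ring

end B3

end Literature.Barriers.CriticalPhenomena

end
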